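import Summits.HodgeConjecture.HodgeConjecture.Theorems.F0P6aStubESHEETOrgans
import HarnessLib

/-!
# `F0P6aStubESHEET` — ★ RE-HOME of `Lines/F0_P6a_StubESHEET.lean`, PART 3 of 3 (size-lint split; cut at a declaration boundary).

## Import provenance
- `Theorems.F0P6aStubESHEETOrgans` = ★ previous part of the same `Lines` workfile `F0_P6a_StubESHEET` (size-lint split ×3); `HarnessLib`.

See PART 1 `Theorems/F0P6aStubESHEETSocket.lean` for the full re-home header and the original module docstring (verbatim there). Namespaces and sections KEPT
(re-opened below exactly as they stand at the cut, with their `open`∕`variable` lines replayed); code bytes = the workfile՚s, docstrings included; options preamble repeated from PART 1.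
HC_CM is proved only modulo the 7 printed citations (2 remaining: hLiu418 = stmt-HodgeConjecture-24832, h413 = stmt-HodgeConjecture-24833) until rung 0 closes; a re-home is count-neutral. -/

set_option autoImplicit false

noncomputable section


namespace Summit.HodgeConjecture.HodgeConjecture.Cruxes.HLiu418.F0P6aStubESHEET
set_option linter.dupNamespace false  -- `Summit.HodgeConjecture.HodgeConjecture.…` BY DESIGN (D-0017)
open CategoryTheory CategoryTheory.Limits NumberField IsDedekindDomain MulAction AlgebraicGeometry
open scoped Matrix Polynomial Pointwise nonZeroDivisors
open Literature.NumberTheory.GaloisRepresentations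
open Literature.NumberTheory.Automorphic Literature.NumberTheory.Automorphic.UnitaryGroup
open Literature.AlgebraicGeometry.ShimuraVarieties Literature.AlgebraicGeometry.ShimuraVarieties.UnitaryCanonicalModel
open Literature.NumberTheory.Automorphic.Liu2021.AppendixC
open Literature.AlgebraicGeometry.Motives (AlgPoints ComplexPoints SchemeOver thickeningLift specOver)
open Literature.AlgebraicGeometry.Motives.AbelianVariety (bcSpec)
open Literature.AlgebraicGeometry.AbelianSchemes (PolarizedAbelianSchemeWithLevel AbelianSchemeOver)
open Literature.AlgebraicGeometry.ModuliOfAbelianVarieties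
open Summit.HodgeConjecture.HodgeConjecture.Cruxes.HLiu418.F0P6aPELWitnessE
open Summit.HodgeConjecture.HodgeConjecture.Cruxes.HLiu418.F0P6aStubE6 (RingActionReading)
open Summit.HodgeConjecture.HodgeConjecture.Cruxes.HLiu418.F0P6aStubKOTT (KottAdaptedAt UnmixedAt)
open Summit.HodgeConjecture.HodgeConjecture.Cruxes.HLiu418.F0P6aEReadings (ETwistKerAt CoverKerE CoverE)
open Summit.HodgeConjecture.HodgeConjecture.Cruxes.HLiu418.F0P6aChartFramePin (IsChartOfFrame)
open Literature.AlgebraicGeometry.Motives (CMType)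
open Literature.AlgebraicGeometry.ShimuraVarieties.UnitaryCanonicalModel.Aux (ratBasis torusFinAdelic reflexField numberField_reflexField)
open Literature.AlgebraicGeometry.ShimuraVarieties.UnitaryCurve Literature.AlgebraicGeometry.ShimuraVarieties.UnitaryCurve.AuxV
open Literature.NumberTheory.ComplexMultiplication (reflexNormFiniteIdele)
open Literature.NumberTheory.ComplexMultiplication.CMTypeOps (flip bar)


set_option maxHeartbeats 400000 in
/-- **`OrganSHEETComplex`** — `OrganSHEET` with its conclusion replaced by the KERNEL-CLAUSE BODY AT THE COMPLEX POINTS OF THE CHART SHEET: for every complex point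
`z` of `Sh_{Kc}`, `coverKerBody ℂ P.A ρ P.D P.pol P.level 𝔞 n (ℓ_{τE} z) (ℓ_{τE∘γ} z)` ((t1)(t1′)(t2)(t3)(t4)(t5) between the fibres of `P` at the `τE`- and the
`τE∘γ`-sheet points over `z`).  ROAD B′∕(β): the Serre tensor `c : P_{ℓ_{τE} z} → P_{ℓ_{τE} z} ⊗ 𝔞⁻¹` of the `[J v, b(a)]`-marked complex fibre (DEAL #32, ★
`SerreTensorConstruction`∕`SiegelAdelicMarking.exists_marking_of_idealKernel`), classified by `pts⁻¹[J v, b(a)·ũ_V(1,z)]` (`C.junction`, #34 ADM ⇒ ISO), which IS the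
`τE∘γ`-sheet point over `z` (LEG-C at CM points ★ p849999, everywhere by #35 continuity + (β1) Hecke-orbit density ★ p849682); (t3)∕(t5) by the readings ★ p849931∕p849861.
(print: Shimura1998, §13.1 Thm. 1 pp. 97–99; §18.6 Thm. 18.6 pp. 124–125) (print: Milne2005ShimuraVarieties, §13 Lemma 13.5 and Thm. 13.6 (p. 118)) (print: RapoportSmithlingZhang2020Diagonal, §3.2 p. 11, §4.3 p. 20) -/
def OrganSHEETComplex : Prop :=
  ∀ (F : Type) [Field F] [NumberField F] [IsCMField F] [IsGalois ℚ F] (ι₁ : F →+* ℂ)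
    (Jstar : Matrix (Fin 2) (Fin 2) F) (hJ : (Jstar.map (IsCMField.complexConj F))ᵀ = Jstar) (hJu : IsUnit Jstar)
    (K₀ : C5.OpenCompactSubgroup (GSAdele F Jstar)) (S : RecordSystemGS F Jstar ι₁ K₀) (_hU7ₛ : S.HeckeTranslateDefinedOver) (Kc : C5.SmallLevel K₀)
    (Fi : Type) [Field Fi] [NumberField Fi] [Algebra F Fi] [IsGalois F Fi] (τE : Fi →+* ℂ) (hτE : τE.comp (algebraMap F Fi) = ι₁)
    (Φ : Set (F →+* ℂ)) (hΦ : IsCMTypeThrough ι₁ Φ) (C : AuxChartGS F ι₁ Jstar K₀ S Kc Fi τE Φ)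
    (ξ : F) (k : ℕ) (Fr : SymplecticFrameV F (RingHom.id F) Jstar ((k : ℚ) • ξ) C.g C.δ) (_hpin : IsChartOfFrame hΦ C ξ k Fr)
    (ε : (Literature.AlgebraicGeometry.Motives.baseChange F Fi).obj (S.M.obj Kc) ⟶
        (Literature.AlgebraicGeometry.Motives.baseChange ℚ Fi).obj C.𝓜.M)
    (_hε : letI : Algebra Fi ℂ := τE.toAlgebra
      ∀ (P : ComplexPoints ((Literature.AlgebraicGeometry.Motives.baseChange F Fi).obj (S.M.obj Kc)))
        (Pflat : letI : Algebra F ℂ := ι₁.toAlgebra; ComplexPoints (S.M.obj Kc)),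
        Pflat.left = P.left ≫ pullback.fst (S.M.obj Kc).hom (bcSpec F Fi) →
        (AlgPoints.map ε P).left ≫ pullback.fst C.𝓜.M.hom (bcSpec ℚ Fi) =
          (letI : Algebra F ℂ := ι₁.toAlgebra; (C.f (S.pts Kc Pflat)).left))
    (ρ : AbelianSchemeOver.RingAction (𝓞 F) (C.𝓜.univ.baseChange (ε.left ≫ pullback.fst C.𝓜.M.hom (bcSpec ℚ Fi))).A),
    RingActionReading C ε ρ →
    ∀ (w : HeightOneSpectrum (𝓞 F)) (_hw : (IsCMField.complexConj F) • w ≠ w)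
      (γ : Fi ≃ₐ[F] Fi) (𝔞 : Ideal (𝓞 F)) (n : ℕ), IsSheetTwistOf ι₁ τE Φ hΦ C.N γ 𝔞 n →
        letI P := C.𝓜.univ.baseChange (ε.left ≫ pullback.fst C.𝓜.M.hom (bcSpec ℚ Fi))
        letI : Algebra F ℂ := ι₁.toAlgebra
  ∀ z : AlgPoints (S.M.obj Kc) ℂ,
    F0P6aCoverEOfComplex.coverKerBody ℂ P.A ρ P.D P.pol P.level 𝔞 n
      (thickeningLift (sheetAlgHom ι₁ τE hτE) (S.M.obj Kc) z).left
      (thickeningLift ((sheetAlgHom ι₁ τE hτE).comp (γ : Fi →ₐ[F] Fi)) (S.M.obj Kc) z).left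

-- Mathlib՚s `Over`∕pull-back API is stated across semireducible wrappers (as in the ★ `AbelianSchemes/*` files and the (W-L4a) leaf): scoped to this declaration.
set_option backward.isDefEq.respectTransparency false in
set_option maxHeartbeats 400000 in
open scoped MonObj Obj in
/-- **`OrganSHEETGlobal` — THE (γ′) GLOBAL SOCKET «SERRE TENSOR OVER X, CLASSIFIED»** (ROAD OF RECORD v3, LA4-plan (g2) 08:48:23Z; the ∃-body = LA4-p01 (g3)
= LA7-p01 (g4)՚s `OrganSHEETGlobalCore` VERBATIM, the conclusion of LEG-E(γ′) GLOBAL GLUE `organSHEETGlobal_of_organs`; consumed by LA4-p01 (g3)՚s §3c′ reduction after a field-dropping projection):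
`OrganSHEET`՚s prefix VERBATIM, then for every sheet twist `IsSheetTwistOf … γE 𝔞 n`: over `X := (Sh_{Kc} ⊗_F Fᵢ).left` there are the twisted `𝒪_F`-PEL tuple
`(B, ρB, DB + Poincaré pin, polB, lvlB)` (LEG-A(γ′) ★ p850615 on `(P.A, ρ)`, `hdual` ★ p850273 + `hproj` ★ p850668, `hT` (N3) ★ p850698∕p850723∕p850691, `hsymp`
★ p849981∕(m1)), the Serre cover `c : P.A → B` with its GLOBAL rows (t1)(t1′)(t2)(t3)(t4)(t5) for `(𝔞, c•𝔞, n)` (★ p850393∕p850615 conjuncts VERBATIM at `Y := X`),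
and a GLOBAL isomorphism of group schemes `E : B ≅ (P.A).baseChange gγ` over `X` (`gγ := GaloisDescent.gal Fᵢ Sh_{Kc} γ₁⁻¹ = 1 × Spec γ₁`) EXACT on the
polarisations (dual-homomorphism form), on the level sections and on the `𝒪_F`-actions (`actB` vs `ρ.baseChange gγ`), plus (surj) and (t5′).  THE ∀∃-BODY IS
LA7-p01 (g4)՚s `OrganSHEETGlobalCore` (HOME `F0/P6/L7/LA7-p01/g4/OrganSHEETGlobalPay.frame.v1.LA7-p01g4.lean` sha16 709ce1f88bbe9864 :701–:735) TOKEN FOR TOKEN —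
ONE DEF, ONE OWNER (pen ruling 09:09:56Z (3); currency settled 10:01Z: «ISO» — ★ `exists_iso_of_tupleRel_id` (`TupleIsoPointCriteria` :90) asks only
`[IsReduced T] [IsLocallyNoetherian T]`, NO `PreconnectedSpace`, and the frame v1 head `organSHEETGlobal_of_organs : OrganB1 → OrganB2 → OrganB3 → OrganSHEETGlobalCore`
is PROVED) — place-free (no `(w, hw)`), `γ₁` (a token clash: `γ` is notation under `open scoped Obj`).  The iso comes from fine moduli (`classifyingMap B = (ε ≫ pr₁) ∘ gγ`:
#42 ★ p850866, #41 ★ p850782∕p850805∕p850830, #38 ★ p850754∕p850842, LEG-C♯ ★ p850759, density ★ p850504, ★ p847561, bridge ★ `exists_iso_of_tupleRel_id`), the action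
clause from (R-CM) ★ p850737∕p850738∕p850815 + (R-RIG) ★ p850641.  Paid by LEG-E(γ′) GLOBAL GLUE (LA7-p01 (g4)
`organSHEETGlobal_of_organs`).  A `Prop`; nothing asserted. (print: Shimura1998, §13.1 Thm. 1 pp. 97–99; §18.6 Thm. 18.6 pp. 124–125)
(print: MumfordFogartyKirwan1994, Ch. 7 §2 Definition 7.2 (p. 129) and Definition 7.3 (p. 130)) (print: Milne2005ShimuraVarieties, §13 Lemma 13.5 and Thm. 13.6 (p. 118)) -/
def OrganSHEETGlobal : Prop :=
  ∀ (F : Type) [Field F] [NumberField F] [IsCMField F] [IsGalois ℚ F] (ι₁ : F →+* ℂ)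
    (Jstar : Matrix (Fin 2) (Fin 2) F) (_hJ : (Jstar.map (IsCMField.complexConj F))ᵀ = Jstar) (_hJu : IsUnit Jstar)
    (K₀ : C5.OpenCompactSubgroup (GSAdele F Jstar)) (S : RecordSystemGS F Jstar ι₁ K₀) (_hU7ₛ : S.HeckeTranslateDefinedOver) (Kc : C5.SmallLevel K₀)
    (Fi : Type) [Field Fi] [NumberField Fi] [Algebra F Fi] [IsGalois F Fi] (τE : Fi →+* ℂ) (_hτE : τE.comp (algebraMap F Fi) = ι₁)
    (Φ : Set (F →+* ℂ)) (hΦ : IsCMTypeThrough ι₁ Φ) (C : AuxChartGS F ι₁ Jstar K₀ S Kc Fi τE Φ)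
    (ξ : F) (k : ℕ) (Fr : SymplecticFrameV F (RingHom.id F) Jstar ((k : ℚ) • ξ) C.g C.δ) (_hpin : IsChartOfFrame hΦ C ξ k Fr)
    (ε : (Literature.AlgebraicGeometry.Motives.baseChange F Fi).obj (S.M.obj Kc) ⟶
        (Literature.AlgebraicGeometry.Motives.baseChange ℚ Fi).obj C.𝓜.M)
    (_hε : letI : Algebra Fi ℂ := τE.toAlgebra
      ∀ (P : ComplexPoints ((Literature.AlgebraicGeometry.Motives.baseChange F Fi).obj (S.M.obj Kc)))
        (Pflat : letI : Algebra F ℂ := ι₁.toAlgebra; ComplexPoints (S.M.obj Kc)),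
        Pflat.left = P.left ≫ pullback.fst (S.M.obj Kc).hom (bcSpec F Fi) →
        (AlgPoints.map ε P).left ≫ pullback.fst C.𝓜.M.hom (bcSpec ℚ Fi) =
          (letI : Algebra F ℂ := ι₁.toAlgebra; (C.f (S.pts Kc Pflat)).left))
    (ρ : AbelianSchemeOver.RingAction (𝓞 F) (C.𝓜.univ.baseChange (ε.left ≫ pullback.fst C.𝓜.M.hom (bcSpec ℚ Fi))).A),
    RingActionReading C ε ρ →
    ∀ (γ₁ : Fi ≃ₐ[F] Fi) (𝔞 : Ideal (𝓞 F)) (n : ℕ), IsSheetTwistOf ι₁ τE Φ hΦ C.N γ₁ 𝔞 n →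
      letI P := C.𝓜.univ.baseChange (ε.left ≫ pullback.fst C.𝓜.M.hom (bcSpec ℚ Fi))
      letI X := (Literature.AlgebraicGeometry.Motives.baseChange F Fi).obj (S.M.obj Kc)
      letI gγ : X.left ⟶ X.left := Literature.AlgebraicGeometry.Motives.GaloisDescent.gal Fi (S.M.obj Kc) γ₁⁻¹
  ∃ (B : AbelianSchemeOver X.left) (actB : AbelianSchemeOver.RingAction (𝓞 F) B) (DB : B.DualPair)
    (_ : Nonempty ((Scheme.Modules.pullback (AbelianSchemeOver.DualPair.unitHatSlice DB)).obj DB.P ≅ SheafOfModules.unit _))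
    (polB : B.Polarization DB) (lvlB : B.LevelStructure C.g C.N) (c : P.A.X ⟶ B.X) (_ : IsMonHom c),
    (∀ x ∈ 𝔞, ∃ d : B.X ⟶ P.A.X, IsMonHom d ∧ c ≫ d = ρ.i x ∧ d ≫ c = actB.i x) ∧
    (∀ ⦃T : Over X.left⦄ (t : T ⟶ P.A.X), t ≫ c = 1 ↔ ∀ x ∈ 𝔞, t ≫ ρ.i x = 1) ∧
    Function.Surjective c.left.base ∧
    (∀ y ∈ (IsCMField.complexConj F) • 𝔞, ∃ f : P.A.X ⟶ B.X, IsMonHom f ∧ c ≫ actB.i y = f ≫ actB.i ((n : ℕ) : 𝓞 F)) ∧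
    c ≫ polB.lam ≫ AbelianSchemeOver.DualPair.dualIsogenyOver c P.D DB = P.pol.lam ≫ P.D.hat.mulN n ∧
    (∀ x : 𝓞 F, ρ.i x ≫ c = c ≫ actB.i x) ∧
    (∀ i, lvlB.σ i = P.level.σ i ≫ c) ∧
    (∀ a : Fin C.g ⊕ Fin C.g → ZMod C.N, lvlB.section_ a = P.level.section_ a ≫ c) ∧
    ∃ (E : B.X ≅ (P.A.baseChange gγ).X) (_ : IsMonHom E.hom),
      E.hom ≫ (P.pol.baseChange gγ).lam ≫ AbelianSchemeOver.DualPair.dualIsogenyOver E.hom DB (P.D.baseChange gγ) = polB.lam ∧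
      (∀ i, lvlB.σ i ≫ E.hom = (P.level.baseChange gγ).σ i) ∧
      ∀ b : 𝓞 F, actB.i b ≫ E.hom = E.hom ≫ (ρ.baseChange gγ).i b

/-- **`hole_SHEET_global` — PAID at ED. 3** by the (T) ★ LEG-E(γ′) GLOBAL GLUE `Theorems/F0P6aStubESHEETGlobalGlue.lean` (LA7-p01 (g4), ★ p851204:
`organSHEETGlobal_holds : OrganSHEETGlobal := organSHEETGlobal_of_organs organB1_holds organB2 organB3_holds`, Theorems currency over ★ p851004 `…GlobalGlueDefs` whose
`OrganSHEETGlobal` is THIS def՚s body token for token (LA4-r01 #65); organs (B1) ★ p850896 LA5-p02 (g4), (B2) ★ p850979∕p851047 LA4-p02 (g2), (B3) ★ p851009 LA4-p03 (g3) →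
★ p851046 LA6-p02 (g3) with `hpt` ★ p850898 LA4-p04 (g4); fine moduli ★ p851011∕p851174; (R-RIG) ★ p850641; (m1) ★ p850824).  The ED. 2 socket (`:= by sorry`) was the
only code-`sorry` of the closer; the transport across the junction-copy namespaces is `exact` (delta), possible once the K3-E shim flip made the chart words
of the Lines closer and of the ★ twins the same constants.
[cite: Shimura1998, §13.1 Thm. 1 pp. 97–99; §18.6 Thm. 18.6 pp. 124–125] [cite: Milne2005ShimuraVarieties, §13 Lemma 13.5 and Thm. 13.6 (p. 118)] -/
theorem hole_SHEET_global : OrganSHEETGlobal :=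
  Summit.HodgeConjecture.HodgeConjecture.Theorems.F0P6aStubESHEETGlobalGlue.organSHEETGlobal_holds

/-! ### §3c′ THE PER-POINT REDUCTION (LA4-p01 (g3) DEAL #39 — HOME `F0/P6/L4/LA4-p01/g3/GlobalSheetRows.v3.LA4-p01g3.lean` sha16 6155dbc5b7b35a6a §1 :56–:98 BY COPY, sorry-free, TRIO; Lines ORIGINAL, it imports only the TREE leaf + ★) -/

-- Mathlib՚s `Over`∕pull-back API is stated across semireducible wrappers (as in the ★ `AbelianSchemes/*` files and the (W-L4a) leaf): scoped to this declaration.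
set_option backward.isDefEq.respectTransparency false in
open scoped MonObj Obj in
open Literature.AlgebraicGeometry.AbelianSchemes.AbelianSchemeOver (baseChangeHom DualPair RingAction) in
open Summit.HodgeConjecture.HodgeConjecture.Cruxes.HLiu418.F0P6aCoverEOfComplex (coverKerBody coverBody) in
set_option maxHeartbeats 400000 in
/-- **THE REDUCTION — the X-level socket rows ⇒ the `coverKerBody` rows at `(ℓ_{eT} z, ℓ_{eT∘γ} z)` for EVERY sheet `eT : Fᵢ →ₐ[F] ℂ` and EVERY complex
point `z`** (so the `OrganSHEETComplex` conclusion := this at `eT := sheetAlgHom ι₁ τE hτE`, `Y₀ := S.M.obj Kc`, `A := P.A`, `D := P.D`, `hD := P.hatNormalised`,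
`pol := P.pol`, `lvl := P.level`).  HYPOTHESES = the socket's ∃-body, unbundled: the twisted tuple `(B, ρB, DB + pin hDB, polB, lvlB)` over `X := (Y₀ ⊗_F Fᵢ).left`,
the cover `c : A → B` with its GLOBAL rows (t1)(t1′)(t2)(t3)(t4)(t5) for `(𝔞, c•𝔞, n)` (★ p850393∕p850615 conjunct shapes), and the GLOBAL exact iso
`E : B ≅ A ×_X gX`, `gX := GaloisDescent.gal Fᵢ Y₀ γ⁻¹ = 1 × Spec γ` (`hElam` dual-homomorphism form, `hEact`, `hEsec` — ★ `exists_iso_of_tupleRel_id` ∕ ★ p847561 output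
shapes with `act₂ := (ρ.baseChange gX).i = fun a => baseChangeHom (ρ.i a) gX`).  PROOF: the sheet law (D) `ℓ_{eT∘γ} z = ℓ_{eT} z ≫ gX` (`pullback.hom_ext`:
★ `gal_fst`∕`gal_snd`, ★ `thickeningLift_left_comp_fst∕snd`, `Spec.map_comp`), then ★ p850783 at `(𝒜, ℬ, 𝒜₂) := (A, B, A)`, `π := gX`, `ℓ := (ℓ_{eT} z).left`.
[cite: Shimura1998, §13.1 Thm. 1 pp. 97–99; §18.6 pp. 124–127] [cite: MumfordFogartyKirwan1994, Ch. 7 §2 Definition 7.2 (p. 129) and Definition 7.3 (p. 130)]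
[cite: GortzWedhorn2020, Section (4.7) (pp. 107–108) and (4.15) (p. 116)] -/
theorem coverKerBody_sheet_of_global_rows {F : Type} [Field F] [NumberField F] [IsCMField F] [Algebra F ℂ] {Y₀ : SchemeOver F}
    {Fi : Type} [Field Fi] [Algebra F Fi] (γE : Fi ≃ₐ[F] Fi)
    (A : AbelianSchemeOver ((Literature.AlgebraicGeometry.Motives.baseChange F Fi).obj Y₀).left)
    (ρ : RingAction (𝓞 F) A) (D : A.DualPair) (hD : Nonempty ((Scheme.Modules.pullback D.unitHatSlice).obj D.P ≅ SheafOfModules.unit _))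
    (pol : A.Polarization D) {g N : ℕ} (lvl : A.LevelStructure g N) (𝔞 : Ideal (𝓞 F)) (n : ℕ)
    -- the twisted tuple over `X`
    (B : AbelianSchemeOver ((Literature.AlgebraicGeometry.Motives.baseChange F Fi).obj Y₀).left) (ρB : RingAction (𝓞 F) B) (DB : B.DualPair)
    (hDB : Nonempty ((Scheme.Modules.pullback DB.unitHatSlice).obj DB.P ≅ SheafOfModules.unit _))
    (polB : B.Polarization DB) (lvlB : B.LevelStructure g N)
    -- the cover and its GLOBAL rows over `X`
    (c : A.X ⟶ B.X) [IsMonHom c]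
    (t1 : ∀ a ∈ 𝔞, ∃ d : B.X ⟶ A.X, c ≫ d = ρ.i a ∧ d ≫ c = ρB.i a)
    (t1' : ∀ ⦃T : Over ((Literature.AlgebraicGeometry.Motives.baseChange F Fi).obj Y₀).left⦄ (t : T ⟶ A.X), t ≫ c = 1 ↔ ∀ a ∈ 𝔞, t ≫ ρ.i a = 1)
    (t2 : ∀ b ∈ (IsCMField.complexConj F) • 𝔞, ∃ f : A.X ⟶ B.X, c ≫ ρB.i b = f ≫ ρB.i (n : 𝓞 F))
    (t3 : c ≫ polB.lam ≫ DualPair.dualIsogenyOver c D DB = pol.lam ≫ D.hat.mulN n)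
    (t4 : ∀ a : 𝓞 F, ρ.i a ≫ c = c ≫ ρB.i a)
    (t5 : ∀ i, lvlB.σ i = lvl.σ i ≫ c)
    -- the GLOBAL exact isomorphism `E : B ≅ A ×_X (1 × Spec γ)`
    (E : B.X ≅ (A.baseChange (Literature.AlgebraicGeometry.Motives.GaloisDescent.gal Fi Y₀ γE⁻¹)).X) [IsMonHom E.hom]
    (hElam : E.hom ≫ (pol.baseChange (Literature.AlgebraicGeometry.Motives.GaloisDescent.gal Fi Y₀ γE⁻¹)).lam ≫
        DualPair.dualIsogenyOver E.hom DB (D.baseChange (Literature.AlgebraicGeometry.Motives.GaloisDescent.gal Fi Y₀ γE⁻¹)) = polB.lam)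
    (hEact : ∀ a : 𝓞 F, ρB.i a ≫ E.hom = E.hom ≫ baseChangeHom (ρ.i a) (Literature.AlgebraicGeometry.Motives.GaloisDescent.gal Fi Y₀ γE⁻¹))
    (hEsec : ∀ i, lvlB.σ i ≫ E.hom = (lvl.baseChange (Literature.AlgebraicGeometry.Motives.GaloisDescent.gal Fi Y₀ γE⁻¹)).σ i)
    -- the sheet and the point
    (eT : Fi →ₐ[F] ℂ) (z : AlgPoints Y₀ ℂ) :
    coverKerBody ℂ A ρ D pol lvl 𝔞 n (thickeningLift eT Y₀ z).left (thickeningLift (eT.comp (γE : Fi →ₐ[F] Fi)) Y₀ z).left := by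
  -- (D) the sheet law `ℓ_{eT∘γ} z = ℓ_{eT} z ≫ (1 × Spec γ)` (★ `thickeningLift_comp_algEquiv_left`)
  have hℓ := Literature.AlgebraicGeometry.Motives.thickeningLift_comp_algEquiv_left eT γE Y₀ z
  rw [hℓ]
  -- (A)(B)(C) ★ `coverKer_rows_readAt_of_iso_baseChange` at `(𝒜, ℬ, 𝒜₂) := (A, B, A)`, `π := gX`, `ℓ := (ℓ_{eT} z).left`
  exact AbelianSchemeOver.coverKer_rows_readAt_of_iso_baseChange ρ ρB ρ D DB D hD hDB hD pol polB pol lvl lvlB lvl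
    (fun a => a ∈ 𝔞) (fun b => b ∈ (IsCMField.complexConj F) • 𝔞) ((n : ℕ) : 𝓞 F) n c
    (Literature.AlgebraicGeometry.Motives.GaloisDescent.gal Fi Y₀ γE⁻¹) E (thickeningLift eT Y₀ z).left t1 t1' t2 t3 t4 t5 hElam hEact hEsec

set_option backward.isDefEq.respectTransparency false in
/-- **SOCKET `hole_SHEET_complex`** (ROAD B′∕(β), hands by name: #32 LA4-p03 (g2), #33 LA4-p05 (g4), #34 A-p14 (g39), #35 LA4-p01 (g3), (β1) LA4-p03 (g2);
glue LA7-p01 (g3)) — NOT proved here. [cite: Shimura1998, §13.1 Thm. 1 pp. 97–99; §18.6] [cite: Milne2005ShimuraVarieties, §13 Lemma 13.5 and Thm. 13.6 (p. 118)] -/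
theorem hole_SHEET_complex : OrganSHEETComplex := by
  intro F _ _ _ _ ι₁ Jstar hJ hJu K₀ S hU7ₛ Kc Fi _ _ _ _ τE hτE Φ hΦ C ξ k Fr hpin ε hε ρ hρ w hw γ 𝔞 n htw
  letI : Algebra F ℂ := ι₁.toAlgebra
  obtain ⟨B, ρB, DB, hDB, polB, lvlB, c, hc, t1, t1', -, t2, t3, t4, t5, -, E, hE, hElam, hEsec, hEact⟩ :=
    hole_SHEET_global F ι₁ Jstar hJ hJu K₀ S hU7ₛ Kc Fi τE hτE Φ hΦ C ξ k Fr hpin ε hε ρ hρ γ 𝔞 n htw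
  haveI := hc; haveI := hE
  intro z
  exact coverKerBody_sheet_of_global_rows γ _ ρ _
    (C.𝓜.univ.baseChange (ε.left ≫ pullback.fst C.𝓜.M.hom (bcSpec ℚ Fi))).hatNormalised _ _ 𝔞 n
    B ρB DB hDB polB lvlB c (fun a ha => by obtain ⟨d, -, h₁, h₂⟩ := t1 a ha; exact ⟨d, h₁, h₂⟩) t1'
    (fun b hb => by obtain ⟨f, -, h⟩ := t2 b hb; exact ⟨f, h⟩) t3 t4 t5 E hElam hEact hEsec (sheetAlgHom ι₁ τE hτE) z

/-- **`stub_SHEET` FROM `hole_SHEET_complex`** (LEG-E, LA7-p01 (g3)): the `F̄_w` rows at every sheet `e′` and point `y` from the complex rows on the chart sheet by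
(S5) ★ p850285∕p850295∕p850145 (`coverKerE_of_complex_sheet`, `σ : F̄_w ≃ₐ[F] ℂ` with `σ ∘ e′ = τE`), Poincaré normalisation `P.hatNormalised`; the cover row is the
kernel row without (t1′). [cite: Shimura1998, §13.1 Thm. 1 pp. 97–99; §18.6] [cite: Lang2002, Ch. VIII §1 and Ch. V §2 Thm. 2.8] -/
theorem stub_SHEET : OrganSHEET := by
  intro F _ _ _ _ ι₁ Jstar hJ hJu K₀ S hU7ₛ Kc Fi _ _ _ _ τE hτE Φ hΦ C ξ k Fr hpin ε hε ρ hρ w hw γ 𝔞 n htw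
  letI : Algebra F ℂ := ι₁.toAlgebra
  have key := hole_SHEET_complex F ι₁ Jstar hJ hJu K₀ S hU7ₛ Kc Fi τE hτE Φ hΦ C ξ k Fr hpin ε hε ρ hρ w hw γ 𝔞 n htw
  have hK := fun (e' : Fi →ₐ[F] AlgebraicClosure (w.adicCompletion F))
      (y : AlgPoints (S.M.obj Kc) (AlgebraicClosure (w.adicCompletion F))) =>
    F0P6aCoverEOfComplex.coverKerE_of_complex_sheet S Kc w _ ρ _
      (C.𝓜.univ.baseChange (ε.left ≫ pullback.fst C.𝓜.M.hom (bcSpec ℚ Fi))).hatNormalised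
      (C.𝓜.univ.baseChange (ε.left ≫ pullback.fst C.𝓜.M.hom (bcSpec ℚ Fi))).pol
      (C.𝓜.univ.baseChange (ε.left ≫ pullback.fst C.𝓜.M.hom (bcSpec ℚ Fi))).level (γ : Fi →ₐ[F] Fi) 𝔞 n
      (sheetAlgHom ι₁ τE hτE) key e' y
  exact ⟨hK, fun e' y => F0P6aCoverEOfComplex.coverE_of_coverKerE S Kc w e' _ ρ _ _ _ _ 𝔞 n y (hK e' y)⟩


/-! ### §4 HEAD — the letter from the two organs -/

set_option maxHeartbeats 400000 in
/-- **HEAD `stub_ESHEET_of_line : StubESHEET`** — the X-leaf socket letter `RecordESheetReading`, PROVED from `stub_TWIST` (twist data + rows + junction) and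
`stub_SHEET` (sheet law at every sheet twist): take `(𝔞_γ, n_γ)` from the arithmetic organ, keep its seven rows, and read the two cover rows off the geometric
organ at the junction witness `IsSheetTwistOf … γ (𝔞_γ) (n_γ)`.  `--axioms` = TRIO ∪ {sorryAx ⇐ the open sockets of the edition} (ED. 3: none ⇒ TRIO).
[cite: Shimura1998, §13.1 Thm. 1 pp. 97–99; §18.6 Thm. 18.6 pp. 124–125] [cite: RapoportSmithlingZhang2020Diagonal, §3.2 p. 11, §4.3 p. 20] -/
theorem stub_ESHEET_of_line : StubESHEET := by
  intro F _ _ _ _ ι₁ Jstar hJ hJu K₀ S hU7ₛ Kc Fi _ _ _ _ τE hτE Φ hΦ C ξ k Fr hpin ε hε ρ hρ w hw hhyp hunit pChar fDeg hp hpw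
    hcard hNdvd had hun e
  obtain ⟨tI, tN, ha, hb, hc, hFa, hFn, hπ, hcan, htw⟩ :=
    stub_TWIST F ι₁ Fi τE hτE Φ hΦ C.N C.hN w hw pChar fDeg hp hpw hcard hNdvd had hun e
  exact ⟨tI, tN, ha, hb, hc, hFa, hFn, hπ, hcan,
    fun e' γ y => (stub_SHEET F ι₁ Jstar hJ hJu K₀ S hU7ₛ Kc Fi τE hτE Φ hΦ C ξ k Fr hpin ε hε ρ hρ w hw γ
      (tI γ) (tN γ) (htw γ)).1 e' y,
    fun e' γ y => (stub_SHEET F ι₁ Jstar hJ hJu K₀ S hU7ₛ Kc Fi τE hτE Φ hΦ C ξ k Fr hpin ε hε ρ hρ w hw γ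
      (tI γ) (tN γ) (htw γ)).2 e' y⟩

end Summit.HodgeConjecture.HodgeConjecture.Cruxes.HLiu418.F0P6aStubESHEET

end
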